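import Mathlib
import Summits.Ventures.PercRepro2.Defs
import Summits.Ventures.PercRepro2.Independence
import Summits.Ventures.PercRepro2.Harris
import Summits.Ventures.PercRepro2.ThreeEventSafe
import Summits.Ventures.PercRepro2.ThreeEventCross
import Summits.Ventures.PercRepro2.ThreeEventCertificate

/-!
# Pointwise certificates with swapped samples (blind cell PercRepro2, p4 g33; proofs/P4-G33-CROSS.md §4c)

The two samples of the double sum are independent and identically distributed, so the defect of a
quadruple is also the double sum of its pair weight with the samples SWAPPED
(`defect_eq_double_sum_swap`). **`crossTerm_ge_of_pointwise_swap`**: a pointwise certificate for the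
cross pair weight may therefore use, besides the pair weights `c₁, c₂` of two quadruples, the swapped
pair weights `c₃(ω', ω), c₄(ω', ω)` of two more — the instance `G = ↑{ac,bc,ad,bd}`, `H = ↑{ab,ac,bd,cd}`,
`B = ↓{ac,bd}` on four coordinates has no certificate of the unswapped kind at any edge but one of this
kind (P4-G33-CROSS §4c). No definition, no instance, no notation.
-/

namespace Summit.Ventures.PercRepro2

namespace ThreeEvent

section Swap

variable {E : Type*} [Fintype E] [DecidableEq E] {R : Type*} [CommRing R]

/-- The defect as a double sum with the samples swapped. -/
theorem defect_eq_double_sum_swap (p : E → R) (G H M B : Set (Config E)) :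
    defect p G H M B = ∑ ω, ∑ ω', weight p ω * weight p ω' * pairWt G H M B ω' ω := by
  rw [defect_eq_double_sum, Finset.sum_comm]
  refine Finset.sum_congr rfl fun ω _ => Finset.sum_congr rfl fun ω' _ => ?_
  ring

end Swap

section Certificate

variable {E : Type*} [Fintype E] [DecidableEq E] {R : Type*} [CommRing R] [LinearOrder R]
  [IsStrictOrderedRing R]

/-- **Pointwise certificates with swapped samples.** If, on configurations with `e` open,
`χ(ω, ω') ≥ λ₁ c₁(ω, ω') + λ₂ c₂(ω, ω') + λ₃ c₃(ω', ω) + λ₄ c₄(ω', ω)` for the pair weights of four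
quadruples, then `X_p(e) ≥ Σ λ_i Ψ_{p[e↦1]}(quadruple i)`. -/
theorem crossTerm_ge_of_pointwise_swap {p : E → R} (hp : IsProbVec p) (e : E)
    (G H M B G₁ H₁ M₁ B₁ G₂ H₂ M₂ B₂ G₃ H₃ M₃ B₃ G₄ H₄ M₄ B₄ : Set (Config E)) (l₁ l₂ l₃ l₄ : R)
    (hcert : ∀ ω ω' : Config E, ω e = true → ω' e = true →
      l₁ * pairWt G₁ H₁ M₁ B₁ ω ω' + l₂ * pairWt G₂ H₂ M₂ B₂ ω ω'
        + l₃ * pairWt G₃ H₃ M₃ B₃ ω' ω + l₄ * pairWt G₄ H₄ M₄ B₄ ω' ω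
        ≤ pairWt G H M B (Function.update ω e false) ω'
          + pairWt G H M B ω (Function.update ω' e false)) :
    l₁ * defect (Function.update p e 1) G₁ H₁ M₁ B₁
      + l₂ * defect (Function.update p e 1) G₂ H₂ M₂ B₂
      + l₃ * defect (Function.update p e 1) G₃ H₃ M₃ B₃
      + l₄ * defect (Function.update p e 1) G₄ H₄ M₄ B₄ ≤ crossTerm p e G H M B := by
  rw [crossTerm_eq_double_sum, defect_eq_double_sum, defect_eq_double_sum,
    defect_eq_double_sum_swap, defect_eq_double_sum_swap]
  simp only [Finset.mul_sum]
  rw [← Finset.sum_add_distrib, ← Finset.sum_add_distrib, ← Finset.sum_add_distrib]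
  refine Finset.sum_le_sum fun ω _ => ?_
  rw [← Finset.sum_add_distrib, ← Finset.sum_add_distrib, ← Finset.sum_add_distrib]
  refine Finset.sum_le_sum fun ω' _ => ?_
  have hq : IsProbVec (Function.update p e 1) := hp.update e zero_le_one le_rfl
  have hw : 0 ≤ weight (Function.update p e 1) ω * weight (Function.update p e 1) ω' :=
    mul_nonneg (weight_nonneg hq ω) (weight_nonneg hq ω')
  by_cases h : ω e = true
  · by_cases h' : ω' e = true
    · have := mul_le_mul_of_nonneg_left (hcert ω ω' h h') hw
      linarith [this]
    · have h'' : ω' e = false := by simpa using h'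
      rw [weight_update_one_eq_zero_of_false p h'']
      simp
  · have h'' : ω e = false := by simpa using h
    rw [weight_update_one_eq_zero_of_false p h'']
    simp

end Certificate

end ThreeEvent

end Summit.Ventures.PercRepro2
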